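import Literature.GroupTheory.SpecificGroups.OrthogonalThreeSymmetricNilpotentOrbitsNotByRank   -- ★ p846873 (this seat): `N(c) = c·E₃₁ ∈ 𝔭`, `antidiagonal_three_over_inv`, `exists_sq_mul_eq_of_orthogonal_conj_cornerSymmetric`; brings ★ p846826, ★ p846842, `unitaryGroupOfForm`
import Literature.LinearAlgebra.Matrix.UnitaryFormAdjointCayley                                 -- ★ `formAdjoint_mul`, `formAdjoint_coe_eq_coe_inv`, `exists_mem_unitaryGroupOfForm_coe_eq` (the form adjoint `θ_J X = J⁻¹ σ(X)ᵀ J`)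
import HarnessLib

/-!
# The `𝔭`-layer at a tame-ramified place, positive half (1∕2): RANK-ONE nilpotent `Ad O(J₀)`-orbits on the `J₀`-SYMMETRIC `3 × 3` matrices are the SQUARE CLASSES —
# `X = μ·v(J₀v)ᵀ` (`v` isotropic), explicit Witt, `X ~ N(c) = c·E₃₁`, and `N(c) ~ N(c′) ⇔ c′ ∈ c·K×²` (⇔ the forms `J₀X`, `J₀X′` represent a common non-zero value)

Topic `Literature/GroupTheory/SpecificGroups`; namespace `Literature.GroupTheory.SpecificGroups`.  THEOREMS ONLY (no definition, no named fact, no instance, no notation,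
no `sorry`).  Cell `pub/hodgecm-mathlib` (crux H413 = `stmt-HodgeConjecture-24833`), «S3-ram» seeding wave (LEAD F0P3a-plan (g12) T11-41∕T11-56; owner∕desk F0P3a-p06 (g15),
table v1.2 row «β V-INT-ram» re-aimed at the `𝔭`-layer per fold v4; seat F0P3-p03 (g14)); companion of ★ p846873 (the negative half `E₃₁ ≁ εE₃₁`) and of ★ p846826 (the
`𝔨 = so(J₀)` layer, where rank classifies); continued in `OrthogonalThreeSymmetricNilpotentOrbits` (rank two and the four-orbit list over `𝔽_q`).  SETTING: `K` any field,
`J₀ = antidiag(1,1,1)` (Mok∕Rogawski), `σ = id`, `O(J₀) = unitaryGroupOfForm id J₀`, and the `J₀`-symmetric part `𝔭 = {X : J₀⁻¹ Xᵀ J₀ = X}` (`= {X : J₀X symmetric}`,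
dim `6`) — the ODD graded layers `K_w(2j+1)∕K_w(2j+2)` of the ramified `U₃` (p05 (g15) census 5aa3c19d §0; B-p14 (g37) cert (iv) §(2)).  RANK ONE (Witt's theorem made
explicit in dimension `3`, no parity hypothesis): `X ∈ 𝔭`, `X² = 0`, `X ≠ 0` ⇒ `X = μ · v (J₀v)ᵀ` with `v ≠ 0` ISOTROPIC (`ᵗv J₀ v = 0`) and `μ ≠ 0`; `O(J₀)` moves `v` to `e₃`
(explicit matrices), so `X ~ N(μ) = μE₃₁`; and `N(c) ~ N(c′) ⇔ c′ = a²c` (⇐ by `diag(a⁻¹, 1, a)`, ⇒ is ★ p846873) — invariantly: two square-zero `X, X′ ∈ 𝔭` are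
`Ad O(J₀)`-conjugate as soon as the rank-one symmetric forms `J₀X`, `J₀X′` represent a COMMON non-zero value (the residue-square-class datum of A-p19 (g26)'s pieces
`P(c)`, ★ p846824).  This is the by-name finite input of a second-layer∕depth-one strata-constancy organ at a tame-ramified place (p05 (g15) sf 380b85a5
`apply_eq_apply_of_depthOne_conj_ramified` takes `O(J̄)`-conjugacy of the depth-one residues as its hypothesis; these files convert (rank, square class) into that
conjugacy, exactly as ★ p846826 served ★ `LevelOnePieceStrataConstancyRamified`).
HONEST LABEL: HC_CM is proved only modulo the printed citations (the 2 remaining named inputs hLiu418 24832, h413 24833) until rung 0 closes; elementary `3 × 3` algebra,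
nothing printed about the transfer is asserted; count-neutral Literature seeding.

* §1 `formAdjoint_id_eq_self_iff_entries` (`X ∈ 𝔭 ⇔ X₃₃ = X₁₁ ∧ X₂₃ = X₁₂ ∧ X₃₂ = X₂₁`), `eq_eta_of_formAdjoint_id_eq_self`, `transpose_mul_eq_mul_of_formAdjoint_eq_self`,
  `transpose_mul_mul_eq_of_mem_orthogonal`, `mul_coe_inv_eq_transpose_mul_of_mem_orthogonal`, `formAdjoint_conj_of_mem` (`Ad O(J₀)` preserves `𝔭`), `coe_mul_conj`,
  `coe_inv_mul_conj_mul_coe`, `rank_le_one_of_mul_self_eq_zero`, `exists_eq_vecMulVec_of_rank_le_one'`, `mul_self_eq_zero_of_rank_le_one_of_isNilpotent`;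
* §2 **`exists_eq_smul_vecMulVec_of_symmetric`** (`X = μ · v(J₀v)ᵀ`, `v` isotropic), **`exists_orthogonal_mulVec_eq_single_of_isotropic`** (explicit Witt),
  **`exists_orthogonal_conj_eq_cornerSymmetric`** (rank-one normal form), **`exists_orthogonal_conj_cornerSymmetric_iff`** (`⇔ ∃ a, c′ = a²c`),
  `dotProduct_mulVec_conj_of_mem`, `dotProduct_cornerSymmetric_form`, **`exists_orthogonal_conj_eq_of_mul_self_eq_zero_of_common_value`**.

## References
* [CollingwoodMcGovern1993] D. Collingwood, W. McGovern, *Nilpotent Orbits in Semisimple Lie Algebras* (1993): §9.3 (rational∕real orbits for classical algebras; square classes).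
* [Wilson2009] R. A. Wilson, *The Finite Simple Groups*, GTM 251 (2009): §3.7.1 p. 70, §3.7.2 p. 71 (`O₃(q)`, isotropic vectors, Witt's lemma in small rank).
* [BruhatTits1972] F. Bruhat, J. Tits, *Groupes réductifs sur un corps local* I, Publ. Math. IHÉS 41 (1972): §10 (congruence filtrations; graded layers of parahorics).
-/

set_option autoImplicit false

open Matrix Literature.NumberTheory.Automorphic Literature.NumberTheory.Automorphic.HermitianLattice Literature.NumberTheory.Automorphic.UnitaryGroup
open Literature.LinearAlgebra.Matrix

namespace Literature.GroupTheory.SpecificGroups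

variable {K : Type*} [Field K]


/-! ## §1 The `J₀`-symmetric part `𝔭`: entries, transposes, conjugation, rank-one bookkeeping -/

section Basics

/-- `det J₀` is a unit. [cite: Wilson2009, §3.7.1 p. 70] -/
theorem isUnit_det_antidiagonal_three_over : IsUnit ((StdForm.antidiagonal 3).over K).det :=
  (Matrix.isUnit_iff_isUnit_det _).1 ((StdForm.antidiagonal 3).isUnit_over K)

/-- `X.map id = X`. [folklore] [cite: Wilson2009, §3.7.1 p. 70] -/
theorem map_ringHom_id_eq (X : Matrix (Fin 3) (Fin 3) K) : X.map (RingHom.id K) = X := by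
  ext i j; rfl

/-- **`X ∈ 𝔭` entrywise**: `J₀⁻¹ Xᵀ J₀ = X` iff `X` is symmetric about the ANTI-diagonal: `X₃₃ = X₁₁`, `X₂₃ = X₁₂`, `X₃₂ = X₂₁` (so `𝔭` has dimension `6`).
[cite: BruhatTits1972, §10] [cite: Wilson2009, §3.7.1 p. 70] -/
theorem formAdjoint_id_eq_self_iff_entries (X : Matrix (Fin 3) (Fin 3) K) :
    ((StdForm.antidiagonal 3).over K)⁻¹ * (X.map (RingHom.id K))ᵀ * (StdForm.antidiagonal 3).over K = X ↔
      X 2 2 = X 0 0 ∧ X 1 2 = X 0 1 ∧ X 2 1 = X 1 0 := by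
  have hT : (X.map (RingHom.id K))ᵀ = !![X 0 0, X 1 0, X 2 0; X 0 1, X 1 1, X 2 1; X 0 2, X 1 2, X 2 2] := by
    ext i j; fin_cases i <;> fin_cases j <;> rfl
  rw [antidiagonal_three_over_inv, antidiagonal_three_over_eq, hT]
  have hL : (!![(0 : K), 0, 1; 0, 1, 0; 1, 0, 0] : Matrix (Fin 3) (Fin 3) K) * !![X 0 0, X 1 0, X 2 0; X 0 1, X 1 1, X 2 1; X 0 2, X 1 2, X 2 2] *
      !![(0 : K), 0, 1; 0, 1, 0; 1, 0, 0] = !![X 2 2, X 1 2, X 0 2; X 2 1, X 1 1, X 0 1; X 2 0, X 1 0, X 0 0] := by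
    ext i j; fin_cases i <;> fin_cases j <;> simp [Matrix.mul_apply, Fin.sum_univ_three]
  rw [hL]
  constructor
  · intro h
    exact ⟨by simpa using congrFun (congrFun h 0) 0, by simpa using congrFun (congrFun h 0) 1, by simpa using congrFun (congrFun h 1) 0⟩
  · rintro ⟨h1, h2, h3⟩
    ext i j; fin_cases i <;> fin_cases j <;> simp [h1, h2, h3]

/-- `X ∈ 𝔭` ⇒ `Xᵀ J₀ = J₀ X` (i.e. `J₀X` is symmetric). [cite: BruhatTits1972, §10] -/
theorem transpose_mul_eq_mul_of_formAdjoint_eq_self {X : Matrix (Fin 3) (Fin 3) K}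
    (hX : ((StdForm.antidiagonal 3).over K)⁻¹ * (X.map (RingHom.id K))ᵀ * (StdForm.antidiagonal 3).over K = X) :
    Xᵀ * (StdForm.antidiagonal 3).over K = (StdForm.antidiagonal 3).over K * X := by
  have h := congrArg (fun M => (StdForm.antidiagonal 3).over K * M) hX
  simp only [← Matrix.mul_assoc, Matrix.mul_nonsing_inv _ isUnit_det_antidiagonal_three_over, Matrix.one_mul, map_ringHom_id_eq] at h
  exact h

/-- For `g ∈ O(J₀)`: `ᵗg J₀ g = J₀`. [cite: Wilson2009, §3.7.1 p. 70] -/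
theorem transpose_mul_mul_eq_of_mem_orthogonal {g : GL (Fin 3) K} (hg : g ∈ unitaryGroupOfForm (RingHom.id K) ((StdForm.antidiagonal 3).over K)) :
    (g : Matrix (Fin 3) (Fin 3) K)ᵀ * (StdForm.antidiagonal 3).over K * (g : Matrix (Fin 3) (Fin 3) K) = (StdForm.antidiagonal 3).over K := by
  have h := mem_unitaryGroupOfForm_iff.1 hg
  rwa [map_ringHom_id_eq] at h

/-- For `g ∈ O(J₀)`: `J₀ g⁻¹ = ᵗg J₀`. [cite: Wilson2009, §3.7.1 p. 70] -/
theorem mul_coe_inv_eq_transpose_mul_of_mem_orthogonal {g : GL (Fin 3) K} (hg : g ∈ unitaryGroupOfForm (RingHom.id K) ((StdForm.antidiagonal 3).over K)) :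
    (StdForm.antidiagonal 3).over K * ((g⁻¹ : GL (Fin 3) K) : Matrix (Fin 3) (Fin 3) K) = (g : Matrix (Fin 3) (Fin 3) K)ᵀ * (StdForm.antidiagonal 3).over K := by
  have h := transpose_mul_mul_eq_of_mem_orthogonal hg
  calc (StdForm.antidiagonal 3).over K * ((g⁻¹ : GL (Fin 3) K) : Matrix (Fin 3) (Fin 3) K)
      = (g : Matrix (Fin 3) (Fin 3) K)ᵀ * (StdForm.antidiagonal 3).over K * (g : Matrix (Fin 3) (Fin 3) K) * ((g⁻¹ : GL (Fin 3) K) : Matrix (Fin 3) (Fin 3) K) := by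
        rw [h]
    _ = (g : Matrix (Fin 3) (Fin 3) K)ᵀ * (StdForm.antidiagonal 3).over K * ((g : Matrix (Fin 3) (Fin 3) K) * ((g⁻¹ : GL (Fin 3) K) : Matrix (Fin 3) (Fin 3) K)) := by
        simp only [Matrix.mul_assoc]
    _ = (g : Matrix (Fin 3) (Fin 3) K)ᵀ * (StdForm.antidiagonal 3).over K := by
        rw [← Units.val_mul, mul_inv_cancel, Units.val_one, Matrix.mul_one]

/-- **`Ad O(J₀)` preserves `𝔭`**: `θ(gXg⁻¹) = g θ(X) g⁻¹` for `g ∈ O(J₀)` (`θ = J₀⁻¹(·)ᵀJ₀` is an anti-homomorphism with `θ(g) = g⁻¹`). [cite: BruhatTits1972, §10] -/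
theorem formAdjoint_conj_of_mem {g : GL (Fin 3) K} (hg : g ∈ unitaryGroupOfForm (RingHom.id K) ((StdForm.antidiagonal 3).over K)) (X : Matrix (Fin 3) (Fin 3) K) :
    ((StdForm.antidiagonal 3).over K)⁻¹ * (((g : Matrix (Fin 3) (Fin 3) K) * X * ((g⁻¹ : GL (Fin 3) K) : Matrix (Fin 3) (Fin 3) K)).map (RingHom.id K))ᵀ *
        (StdForm.antidiagonal 3).over K =
      (g : Matrix (Fin 3) (Fin 3) K) * (((StdForm.antidiagonal 3).over K)⁻¹ * (X.map (RingHom.id K))ᵀ * (StdForm.antidiagonal 3).over K) *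
        ((g⁻¹ : GL (Fin 3) K) : Matrix (Fin 3) (Fin 3) K) := by
  have hJ := (isUnit_det_antidiagonal_three_over (K := K))
  rw [formAdjoint_mul (RingHom.id K) hJ, formAdjoint_mul (RingHom.id K) hJ, formAdjoint_coe_eq_coe_inv (RingHom.id K) hJ hg,
    formAdjoint_coe_eq_coe_inv (RingHom.id K) hJ (inv_mem hg), inv_inv]
  simp only [Matrix.mul_assoc]

/-- Conjugating by a product: `(hg) X (hg)⁻¹ = h (g X g⁻¹) h⁻¹`. [folklore] [cite: Wilson2009, §3.7.1 p. 70] -/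
theorem coe_mul_conj (h g : GL (Fin 3) K) (X : Matrix (Fin 3) (Fin 3) K) :
    ((h * g : GL (Fin 3) K) : Matrix (Fin 3) (Fin 3) K) * X * (((h * g)⁻¹ : GL (Fin 3) K) : Matrix (Fin 3) (Fin 3) K) =
      (h : Matrix (Fin 3) (Fin 3) K) * ((g : Matrix (Fin 3) (Fin 3) K) * X * ((g⁻¹ : GL (Fin 3) K) : Matrix (Fin 3) (Fin 3) K)) *
        ((h⁻¹ : GL (Fin 3) K) : Matrix (Fin 3) (Fin 3) K) := by
  rw [_root_.mul_inv_rev, Units.val_mul, Units.val_mul]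
  simp only [Matrix.mul_assoc]

/-- Undoing a conjugation: `g⁻¹ (g X g⁻¹) g = X`. [folklore] [cite: Wilson2009, §3.7.1 p. 70] -/
theorem coe_inv_mul_conj_mul_coe (g : GL (Fin 3) K) (X : Matrix (Fin 3) (Fin 3) K) :
    ((g⁻¹ : GL (Fin 3) K) : Matrix (Fin 3) (Fin 3) K) * ((g : Matrix (Fin 3) (Fin 3) K) * X * ((g⁻¹ : GL (Fin 3) K) : Matrix (Fin 3) (Fin 3) K)) *
        (g : Matrix (Fin 3) (Fin 3) K) = X := by
  have h1 : ((g⁻¹ : GL (Fin 3) K) : Matrix (Fin 3) (Fin 3) K) * (g : Matrix (Fin 3) (Fin 3) K) = 1 := by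
    rw [← Units.val_mul, inv_mul_cancel, Units.val_one]
  calc _ = ((g⁻¹ : GL (Fin 3) K) : Matrix (Fin 3) (Fin 3) K) * (g : Matrix (Fin 3) (Fin 3) K) * X *
        (((g⁻¹ : GL (Fin 3) K) : Matrix (Fin 3) (Fin 3) K) * (g : Matrix (Fin 3) (Fin 3) K)) := by simp only [Matrix.mul_assoc]
    _ = X := by rw [h1, Matrix.one_mul, Matrix.mul_one]

/-- `X² = 0` in `M₃(K)` forces `rank X ≤ 1` (`range X ⊆ ker X` and rank–nullity `3 = rank + nullity`). [folklore] [cite: CollingwoodMcGovern1993, §9.3] -/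
theorem rank_le_one_of_mul_self_eq_zero {X : Matrix (Fin 3) (Fin 3) K} (h : X * X = 0) : X.rank ≤ 1 := by
  have hle : LinearMap.range X.mulVecLin ≤ LinearMap.ker X.mulVecLin := by
    rintro _ ⟨y, rfl⟩
    rw [LinearMap.mem_ker, Matrix.mulVecLin_apply, Matrix.mulVecLin_apply, Matrix.mulVec_mulVec, h, Matrix.zero_mulVec]
  have hsum := LinearMap.finrank_range_add_finrank_ker X.mulVecLin
  rw [Module.finrank_fin_fun] at hsum
  have hmono := Submodule.finrank_mono hle
  unfold Matrix.rank
  omega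

/-- A matrix of rank `≤ 1` over a field is an outer product `v wᵀ`. [folklore] [cite: CollingwoodMcGovern1993, §9.3] -/
theorem exists_eq_vecMulVec_of_rank_le_one' {X : Matrix (Fin 3) (Fin 3) K} (h : X.rank ≤ 1) : ∃ v w : Fin 3 → K, X = vecMulVec v w := by
  obtain ⟨v, hv⟩ := finrank_le_one_iff.mp h
  have hcol : ∀ j, ∃ a : K, ∀ i, a * (v : Fin 3 → K) i = X i j := fun j => by
    have hj : X.col j ∈ LinearMap.range X.mulVecLin := ⟨Pi.single j 1, by rw [Matrix.mulVecLin_apply, Matrix.mulVec_single_one]⟩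
    obtain ⟨a, ha⟩ := hv ⟨X.col j, hj⟩
    refine ⟨a, fun i => ?_⟩
    have := congrArg (fun w : LinearMap.range X.mulVecLin => (w : Fin 3 → K) i) ha
    simpa using this
  choose a ha using hcol
  exact ⟨v, a, Matrix.ext fun i j => by rw [vecMulVec_apply, ← ha j i, mul_comm]⟩

/-- A NILPOTENT matrix of rank `≤ 1` is square-zero (`X = vwᵀ`, `X³ = (w·v)²X = 0 ≠ X` forces `w·v = 0`). [folklore] [cite: CollingwoodMcGovern1993, §9.3] -/
theorem mul_self_eq_zero_of_rank_le_one_of_isNilpotent {X : Matrix (Fin 3) (Fin 3) K} (h : X.rank ≤ 1) (hnil : IsNilpotent X) : X * X = 0 := by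
  obtain ⟨v, w, rfl⟩ := exists_eq_vecMulVec_of_rank_le_one' h
  have h3 := (isNilpotent_iff_pow_three_eq_zero _).1 hnil
  have hsq : vecMulVec v w * vecMulVec v w = (w ⬝ᵥ v) • vecMulVec v w := by rw [vecMulVec_mul_vecMulVec, vecMulVec_smul]
  by_cases hX : vecMulVec v w = 0
  · rw [hX, Matrix.mul_zero]
  have hcube : vecMulVec v w ^ 3 = ((w ⬝ᵥ v) * (w ⬝ᵥ v)) • vecMulVec v w := by
    rw [pow_succ, pow_two, hsq, Matrix.smul_mul, hsq, smul_smul]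
  rw [hcube, smul_eq_zero] at h3
  rcases h3 with h0 | h0
  · rw [hsq, mul_self_eq_zero.1 h0, zero_smul]
  · exact absurd h0 hX

end Basics

/-! ## §2 Rank one: `X = μ·v(J₀v)ᵀ` with `v` isotropic; Witt moves `v` to `e₃`; `X ~ N(μ)`; `N(c) ~ N(c′) ⇔ c′ ∈ cK×²` -/

section RankOne

/-- **STRUCTURE OF A RANK-ONE ELEMENT OF `𝔭`**: if `X ∈ 𝔭`, `X² = 0`, `X ≠ 0`, then `X = μ · v (J₀v)ᵀ` with `μ ≠ 0`, `v ≠ 0` and `v` ISOTROPIC (`ᵗv J₀ v = 0`).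
(`X = vwᵀ` has rank one; `XᵀJ₀ = J₀X` reads `w(J₀v)ᵀ = (J₀v)wᵀ`, so `w ∥ J₀v`; then `X² = μ(ᵗvJ₀v)·X`.) [cite: CollingwoodMcGovern1993, §9.3] [cite: Wilson2009, §3.7.2 p. 71] -/
theorem exists_eq_smul_vecMulVec_of_symmetric {X : Matrix (Fin 3) (Fin 3) K}
    (hX : ((StdForm.antidiagonal 3).over K)⁻¹ * (X.map (RingHom.id K))ᵀ * (StdForm.antidiagonal 3).over K = X) (h0 : X * X = 0) (hne : X ≠ 0) :
    ∃ μ : K, ∃ v : Fin 3 → K, μ ≠ 0 ∧ v ≠ 0 ∧ v ⬝ᵥ (((StdForm.antidiagonal 3).over K) *ᵥ v) = 0 ∧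
      X = μ • vecMulVec v (((StdForm.antidiagonal 3).over K) *ᵥ v) := by
  obtain ⟨v, w, rfl⟩ := exists_eq_vecMulVec_of_rank_le_one' (rank_le_one_of_mul_self_eq_zero h0)
  have hv : v ≠ 0 := fun h => hne (by rw [h, zero_vecMulVec])
  have hw : w ≠ 0 := fun h => hne (by rw [h, vecMulVec_zero])
  have hsym := transpose_mul_eq_mul_of_formAdjoint_eq_self hX
  rw [transpose_vecMulVec, vecMulVec_mul, mul_vecMulVec] at hsym
  -- `hsym : vecMulVec w (v ᵥ* J₀) = vecMulVec (J₀ *ᵥ v) w`; and `v ᵥ* J₀ = J₀ *ᵥ v` (`J₀` symmetric)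
  have hJT : ((StdForm.antidiagonal 3).over K)ᵀ = (StdForm.antidiagonal 3).over K := by
    rw [antidiagonal_three_over_eq]; ext i j; fin_cases i <;> fin_cases j <;> rfl
  have hvJ : v ᵥ* ((StdForm.antidiagonal 3).over K) = ((StdForm.antidiagonal 3).over K) *ᵥ v := by
    rw [← Matrix.mulVec_transpose, hJT]
  rw [hvJ] at hsym
  set z : Fin 3 → K := ((StdForm.antidiagonal 3).over K) *ᵥ v with hz
  have hz0 : z ≠ 0 := by
    intro h
    apply hv
    have := congrArg (fun y => ((StdForm.antidiagonal 3).over K)⁻¹ *ᵥ y) h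
    simpa only [hz, Matrix.mulVec_mulVec, Matrix.nonsing_inv_mul _ isUnit_det_antidiagonal_three_over, Matrix.one_mulVec, Matrix.mulVec_zero] using this
  obtain ⟨k, hk⟩ := Function.ne_iff.1 hz0
  have hk' : z k ≠ 0 := by simpa using hk
  have happ := congrArg (fun M : Matrix (Fin 3) (Fin 3) K => M *ᵥ Pi.single k 1) hsym
  simp only [vecMulVec_mulVec, dotProduct_single, mul_one, op_smul_eq_smul] at happ
  -- `happ : z k • w = w k • z`
  obtain ⟨μ, rfl⟩ : ∃ μ : K, w = μ • z := ⟨(z k)⁻¹ * w k, by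
    have := congrArg (fun y => (z k)⁻¹ • y) happ
    simp only [smul_smul, inv_mul_cancel₀ hk', one_smul] at this
    exact this⟩
  have hμ0 : μ ≠ 0 := by
    rintro rfl; exact hw (zero_smul K z)
  refine ⟨μ, v, hμ0, hv, ?_, by rw [vecMulVec_smul]⟩
  -- isotropy from `X² = μ (z·v) X = 0`
  have hsq : vecMulVec v (μ • z) * vecMulVec v (μ • z) = (μ * (z ⬝ᵥ v)) • vecMulVec v (μ • z) := by
    rw [vecMulVec_mul_vecMulVec, smul_dotProduct, smul_eq_mul, vecMulVec_smul, vecMulVec_smul]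
  rw [h0] at hsq
  rcases smul_eq_zero.1 hsq.symm with h | h
  · rcases mul_eq_zero.1 h with h | h
    · exact absurd h hμ0
    · rwa [dotProduct_comm] at h
  · exact absurd h hne

/-- **EXPLICIT WITT IN DIMENSION THREE**: every non-zero isotropic vector `v` (`ᵗvJ₀v = 2v₁v₃ + v₂² = 0`) is moved to `e₃` by some `g ∈ O(J₀)`, and then `(J₀v)ᵀ g⁻¹ = e₁ᵀ`
(`g⁻¹ = (v₃⁻¹e₁ ∣ −(v₂∕v₃)e₁ + e₂ ∣ v)` if `v₃ ≠ 0`; the rescaled hyperbolic swap `e₁ ↔ e₃` if `v = v₁e₁`). [cite: Wilson2009, §3.7.2 p. 71] -/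
theorem exists_orthogonal_mulVec_eq_single_of_isotropic {v : Fin 3 → K} (hv : v ≠ 0) (hiso : v ⬝ᵥ (((StdForm.antidiagonal 3).over K) *ᵥ v) = 0) :
    ∃ g : GL (Fin 3) K, g ∈ unitaryGroupOfForm (RingHom.id K) ((StdForm.antidiagonal 3).over K) ∧
      (g : Matrix (Fin 3) (Fin 3) K) *ᵥ v = Pi.single 2 1 ∧
      (((StdForm.antidiagonal 3).over K) *ᵥ v) ᵥ* ((g⁻¹ : GL (Fin 3) K) : Matrix (Fin 3) (Fin 3) K) = Pi.single 0 1 := by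
  have hJ := (isUnit_det_antidiagonal_three_over (K := K))
  have hiso' : v 0 * v 2 + v 1 * v 1 + v 2 * v 0 = 0 := by
    rw [antidiagonal_three_over_eq] at hiso
    simpa [Matrix.mulVec, dotProduct, Fin.sum_univ_three] using hiso
  by_cases h2z : v 2 = 0
  · -- then `v 1 = 0`, `v 0 ≠ 0`; use the rescaled hyperbolic swap
    have h1z : v 1 = 0 := by
      rw [h2z, mul_zero, zero_mul, zero_add, add_zero] at hiso'
      exact mul_self_eq_zero.1 hiso'
    have h0z : v 0 ≠ 0 := by
      intro h; apply hv; ext i; fin_cases i <;> simp [h, h1z, h2z]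
    have hT : ((!![0, 0, v 0; 0, 1, 0; (v 0)⁻¹, 0, 0] : Matrix (Fin 3) (Fin 3) K).map (RingHom.id K))ᵀ = !![0, 0, (v 0)⁻¹; 0, 1, 0; v 0, 0, 0] := by
      ext i j; fin_cases i <;> fin_cases j <;> rfl
    have hθW : ((StdForm.antidiagonal 3).over K)⁻¹ * ((!![0, 0, v 0; 0, 1, 0; (v 0)⁻¹, 0, 0] : Matrix (Fin 3) (Fin 3) K).map (RingHom.id K))ᵀ *
        (StdForm.antidiagonal 3).over K = !![0, 0, v 0; 0, 1, 0; (v 0)⁻¹, 0, 0] := by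
      rw [hT, antidiagonal_three_over_inv, antidiagonal_three_over_eq]
      ext i j; fin_cases i <;> fin_cases j <;> simp [Matrix.mul_apply, Fin.sum_univ_three]
    have h1 : ((StdForm.antidiagonal 3).over K)⁻¹ * ((!![0, 0, v 0; 0, 1, 0; (v 0)⁻¹, 0, 0] : Matrix (Fin 3) (Fin 3) K).map (RingHom.id K))ᵀ *
        (StdForm.antidiagonal 3).over K * !![0, 0, v 0; 0, 1, 0; (v 0)⁻¹, 0, 0] = 1 := by
      rw [hθW]; ext i j; fin_cases i <;> fin_cases j <;> simp [Matrix.mul_apply, Fin.sum_univ_three, h0z]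
    obtain ⟨g, hg, hgW⟩ := exists_mem_unitaryGroupOfForm_coe_eq (RingHom.id K) hJ h1
    have hginv : ((g⁻¹ : GL (Fin 3) K) : Matrix (Fin 3) (Fin 3) K) = !![0, 0, v 0; 0, 1, 0; (v 0)⁻¹, 0, 0] := by
      rw [← formAdjoint_coe_eq_coe_inv (RingHom.id K) hJ hg, hgW, hθW]
    refine ⟨g, hg, ?_, ?_⟩
    · rw [hgW]; ext i; fin_cases i <;> simp [Matrix.mulVec, dotProduct, Fin.sum_univ_three, h1z, h2z, h0z]
    · rw [hginv, antidiagonal_three_over_eq]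
      ext j; fin_cases j <;> simp [Matrix.mulVec, Matrix.vecMul, dotProduct, Fin.sum_univ_three, h1z, h2z, h0z]
  · -- `v 2 ≠ 0`: `g = (v₃, v₂, v₁ ; 0, 1, −v₂∕v₃ ; 0, 0, v₃⁻¹)`, `g⁻¹ = θ(g) = (v₃⁻¹, −v₂∕v₃, v₁ ; 0, 1, v₂ ; 0, 0, v₃)`
    have hT : ((!![v 2, v 1, v 0; 0, 1, -(v 1 / v 2); 0, 0, (v 2)⁻¹] : Matrix (Fin 3) (Fin 3) K).map (RingHom.id K))ᵀ =
        !![v 2, 0, 0; v 1, 1, 0; v 0, -(v 1 / v 2), (v 2)⁻¹] := by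
      ext i j; fin_cases i <;> fin_cases j <;> rfl
    have hθW : ((StdForm.antidiagonal 3).over K)⁻¹ * ((!![v 2, v 1, v 0; 0, 1, -(v 1 / v 2); 0, 0, (v 2)⁻¹] : Matrix (Fin 3) (Fin 3) K).map (RingHom.id K))ᵀ *
        (StdForm.antidiagonal 3).over K = !![(v 2)⁻¹, -(v 1 / v 2), v 0; 0, 1, v 1; 0, 0, v 2] := by
      rw [hT, antidiagonal_three_over_inv, antidiagonal_three_over_eq]
      ext i j; fin_cases i <;> fin_cases j <;> simp [Matrix.mul_apply, Fin.sum_univ_three]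
    have h1 : ((StdForm.antidiagonal 3).over K)⁻¹ * ((!![v 2, v 1, v 0; 0, 1, -(v 1 / v 2); 0, 0, (v 2)⁻¹] : Matrix (Fin 3) (Fin 3) K).map (RingHom.id K))ᵀ *
        (StdForm.antidiagonal 3).over K * !![v 2, v 1, v 0; 0, 1, -(v 1 / v 2); 0, 0, (v 2)⁻¹] = 1 := by
      rw [hθW]; ext i j; fin_cases i <;> fin_cases j <;> simp [Matrix.mul_apply, Fin.sum_univ_three, h2z]
      all_goals first | ring1 | (field_simp; linear_combination hiso')
    obtain ⟨g, hg, hgW⟩ := exists_mem_unitaryGroupOfForm_coe_eq (RingHom.id K) hJ h1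
    have hginv : ((g⁻¹ : GL (Fin 3) K) : Matrix (Fin 3) (Fin 3) K) = !![(v 2)⁻¹, -(v 1 / v 2), v 0; 0, 1, v 1; 0, 0, v 2] := by
      rw [← formAdjoint_coe_eq_coe_inv (RingHom.id K) hJ hg, hgW, hθW]
    refine ⟨g, hg, ?_, ?_⟩
    · rw [hgW]; ext i; fin_cases i <;> simp [Matrix.mulVec, dotProduct, Fin.sum_univ_three, h2z]
      linear_combination hiso'
    · rw [hginv, antidiagonal_three_over_eq]
      ext j; fin_cases j <;> simp [Matrix.mulVec, Matrix.vecMul, dotProduct, Fin.sum_univ_three, h2z]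
      all_goals first | linear_combination hiso' | (field_simp; ring1)

/-- **RANK-ONE NORMAL FORM**: `X ∈ 𝔭`, `X² = 0`, `X ≠ 0` ⇒ `g X g⁻¹ = N(c) = c·E₃₁` for some `g ∈ O(J₀)` and `c ≠ 0`. [cite: CollingwoodMcGovern1993, §9.3] [cite: Wilson2009, §3.7.2 p. 71] -/
theorem exists_orthogonal_conj_eq_cornerSymmetric {X : Matrix (Fin 3) (Fin 3) K}
    (hX : ((StdForm.antidiagonal 3).over K)⁻¹ * (X.map (RingHom.id K))ᵀ * (StdForm.antidiagonal 3).over K = X) (h0 : X * X = 0) (hne : X ≠ 0) :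
    ∃ c : K, c ≠ 0 ∧ ∃ g : GL (Fin 3) K, g ∈ unitaryGroupOfForm (RingHom.id K) ((StdForm.antidiagonal 3).over K) ∧
      (g : Matrix (Fin 3) (Fin 3) K) * X * ((g⁻¹ : GL (Fin 3) K) : Matrix (Fin 3) (Fin 3) K) = !![0, 0, 0; 0, 0, 0; c, 0, 0] := by
  obtain ⟨μ, v, hμ, hv, hiso, rfl⟩ := exists_eq_smul_vecMulVec_of_symmetric hX h0 hne
  obtain ⟨g, hg, hgv, hvg⟩ := exists_orthogonal_mulVec_eq_single_of_isotropic hv hiso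
  refine ⟨μ, hμ, g, hg, ?_⟩
  rw [Matrix.mul_smul, Matrix.smul_mul, mul_vecMulVec, vecMulVec_mul, hgv, hvg]
  ext i j; fin_cases i <;> fin_cases j <;> simp [vecMulVec_apply]

/-- **SQUARE CLASSES**: for `c, c′ ≠ 0`, `N(c)` and `N(c′)` are `Ad O(J₀)`-conjugate iff `c′ = a²c` for some `a` (`⇐`: `g = diag(a⁻¹, 1, a) ∈ O(J₀)`; `⇒`: ★ p846873).
[cite: CollingwoodMcGovern1993, §9.3] [cite: Wilson2009, §3.7.2 p. 71] -/
theorem exists_orthogonal_conj_cornerSymmetric_iff {c c' : K} (hc' : c' ≠ 0) :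
    (∃ g : GL (Fin 3) K, g ∈ unitaryGroupOfForm (RingHom.id K) ((StdForm.antidiagonal 3).over K) ∧
      (g : Matrix (Fin 3) (Fin 3) K) * !![0, 0, 0; 0, 0, 0; c, 0, 0] * ((g⁻¹ : GL (Fin 3) K) : Matrix (Fin 3) (Fin 3) K) = !![0, 0, 0; 0, 0, 0; c', 0, 0]) ↔
    ∃ a : K, c' = a ^ 2 * c := by
  have hJ := isUnit_det_antidiagonal_three_over (K := K)
  constructor
  · rintro ⟨g, hg, hconj⟩
    have hmat : (g : Matrix (Fin 3) (Fin 3) K) * !![0, 0, 0; 0, 0, 0; c, 0, 0] = !![0, 0, 0; 0, 0, 0; c', 0, 0] * (g : Matrix (Fin 3) (Fin 3) K) := by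
      have h := congrArg (fun M : Matrix (Fin 3) (Fin 3) K => M * (g : Matrix (Fin 3) (Fin 3) K)) hconj
      simp only [Matrix.mul_assoc] at h
      rw [← Units.val_mul, inv_mul_cancel, Units.val_one, Matrix.mul_one] at h
      exact h
    exact exists_sq_mul_eq_of_orthogonal_conj_cornerSymmetric hg hc' hmat
  · rintro ⟨a, rfl⟩
    have ha : a ≠ 0 := by rintro rfl; exact hc' (by ring)
    have hT : ((!![a⁻¹, 0, 0; 0, 1, 0; 0, 0, a] : Matrix (Fin 3) (Fin 3) K).map (RingHom.id K))ᵀ = !![a⁻¹, 0, 0; 0, 1, 0; 0, 0, a] := by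
      ext i j; fin_cases i <;> fin_cases j <;> rfl
    have hθW : ((StdForm.antidiagonal 3).over K)⁻¹ * ((!![a⁻¹, 0, 0; 0, 1, 0; 0, 0, a] : Matrix (Fin 3) (Fin 3) K).map (RingHom.id K))ᵀ *
        (StdForm.antidiagonal 3).over K = !![a, 0, 0; 0, 1, 0; 0, 0, a⁻¹] := by
      rw [hT, antidiagonal_three_over_inv, antidiagonal_three_over_eq]
      ext i j; fin_cases i <;> fin_cases j <;> simp [Matrix.mul_apply, Fin.sum_univ_three]
    have h1 : ((StdForm.antidiagonal 3).over K)⁻¹ * ((!![a⁻¹, 0, 0; 0, 1, 0; 0, 0, a] : Matrix (Fin 3) (Fin 3) K).map (RingHom.id K))ᵀ *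
        (StdForm.antidiagonal 3).over K * !![a⁻¹, 0, 0; 0, 1, 0; 0, 0, a] = 1 := by
      rw [hθW]; ext i j; fin_cases i <;> fin_cases j <;> simp [Matrix.mul_apply, Fin.sum_univ_three, ha]
    obtain ⟨g, hg, hgW⟩ := exists_mem_unitaryGroupOfForm_coe_eq (RingHom.id K) hJ h1
    have hginv : ((g⁻¹ : GL (Fin 3) K) : Matrix (Fin 3) (Fin 3) K) = !![a, 0, 0; 0, 1, 0; 0, 0, a⁻¹] := by
      rw [← formAdjoint_coe_eq_coe_inv (RingHom.id K) hJ hg, hgW, hθW]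
    refine ⟨g, hg, ?_⟩
    rw [hgW, hginv]
    ext i j; fin_cases i <;> fin_cases j <;> simp [Matrix.mul_apply, Fin.sum_univ_three]
    ring

/-- **The represented values are `Ad O(J₀)`-invariant**: `ᵗu J₀ (g⁻¹Yg) u = ᵗ(gu) J₀ Y (gu)` for `g ∈ O(J₀)`. [cite: Wilson2009, §3.7.1 p. 70] -/
theorem dotProduct_mulVec_conj_of_mem {g : GL (Fin 3) K} (hg : g ∈ unitaryGroupOfForm (RingHom.id K) ((StdForm.antidiagonal 3).over K))
    (Y : Matrix (Fin 3) (Fin 3) K) (u : Fin 3 → K) :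
    u ⬝ᵥ (((StdForm.antidiagonal 3).over K * (((g⁻¹ : GL (Fin 3) K) : Matrix (Fin 3) (Fin 3) K) * Y * (g : Matrix (Fin 3) (Fin 3) K))) *ᵥ u) =
      ((g : Matrix (Fin 3) (Fin 3) K) *ᵥ u) ⬝ᵥ (((StdForm.antidiagonal 3).over K * Y) *ᵥ ((g : Matrix (Fin 3) (Fin 3) K) *ᵥ u)) := by
  have h := mul_coe_inv_eq_transpose_mul_of_mem_orthogonal hg
  have hM : (StdForm.antidiagonal 3).over K * (((g⁻¹ : GL (Fin 3) K) : Matrix (Fin 3) (Fin 3) K) * Y * (g : Matrix (Fin 3) (Fin 3) K)) =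
      (g : Matrix (Fin 3) (Fin 3) K)ᵀ * ((StdForm.antidiagonal 3).over K * Y) * (g : Matrix (Fin 3) (Fin 3) K) := by
    calc _ = (StdForm.antidiagonal 3).over K * ((g⁻¹ : GL (Fin 3) K) : Matrix (Fin 3) (Fin 3) K) * Y * (g : Matrix (Fin 3) (Fin 3) K) := by
          simp only [Matrix.mul_assoc]
      _ = _ := by rw [h]; simp only [Matrix.mul_assoc]
  rw [hM, ← Matrix.mulVec_mulVec, ← Matrix.mulVec_mulVec, Matrix.dotProduct_mulVec, Matrix.vecMul_transpose]

/-- The form of `N(c)`: `ᵗw J₀ N(c) w = c·w₁²` — so `J₀N(c)` represents exactly the class `c·K×²`. [cite: CollingwoodMcGovern1993, §9.3] -/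
theorem dotProduct_cornerSymmetric_form (c : K) (w : Fin 3 → K) :
    w ⬝ᵥ (((StdForm.antidiagonal 3).over K * !![0, 0, 0; 0, 0, 0; c, 0, 0]) *ᵥ w) = c * w 0 ^ 2 := by
  rw [antidiagonal_three_over_eq]
  have h : (!![(0 : K), 0, 1; 0, 1, 0; 1, 0, 0] : Matrix (Fin 3) (Fin 3) K) * !![0, 0, 0; 0, 0, 0; c, 0, 0] = !![c, 0, 0; 0, 0, 0; 0, 0, 0] := by
    ext i j; fin_cases i <;> fin_cases j <;> simp [Matrix.mul_apply, Fin.sum_univ_three]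
  rw [h]
  simp [Matrix.mulVec, dotProduct, Fin.sum_univ_three]
  ring

/-- **RANK-ONE CONJUGACY CRITERION (common value)**: two square-zero `X, X′ ∈ 𝔭` whose symmetric forms `J₀X`, `J₀X′` represent a COMMON non-zero value `d` are
`Ad O(J₀)`-conjugate (normal forms `N(c)`, `N(c′)` with `d = c s² = c′ s′²`). [cite: CollingwoodMcGovern1993, §9.3] [cite: Wilson2009, §3.7.2 p. 71] -/
theorem exists_orthogonal_conj_eq_of_mul_self_eq_zero_of_common_value {X X' : Matrix (Fin 3) (Fin 3) K}
    (hX : ((StdForm.antidiagonal 3).over K)⁻¹ * (X.map (RingHom.id K))ᵀ * (StdForm.antidiagonal 3).over K = X)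
    (hX' : ((StdForm.antidiagonal 3).over K)⁻¹ * (X'.map (RingHom.id K))ᵀ * (StdForm.antidiagonal 3).over K = X')
    (h0 : X * X = 0) (h0' : X' * X' = 0) {u u' : Fin 3 → K} {d : K} (hd : d ≠ 0)
    (hu : u ⬝ᵥ (((StdForm.antidiagonal 3).over K * X) *ᵥ u) = d) (hu' : u' ⬝ᵥ (((StdForm.antidiagonal 3).over K * X') *ᵥ u') = d) :
    ∃ g : GL (Fin 3) K, g ∈ unitaryGroupOfForm (RingHom.id K) ((StdForm.antidiagonal 3).over K) ∧
      (g : Matrix (Fin 3) (Fin 3) K) * X * ((g⁻¹ : GL (Fin 3) K) : Matrix (Fin 3) (Fin 3) K) = X' := by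
  have hne : X ≠ 0 := by rintro rfl; apply hd; rw [← hu]; simp
  have hne' : X' ≠ 0 := by rintro rfl; apply hd; rw [← hu']; simp
  obtain ⟨c, hc, g, hg, hgX⟩ := exists_orthogonal_conj_eq_cornerSymmetric hX h0 hne
  obtain ⟨c', hc', g', hg', hgX'⟩ := exists_orthogonal_conj_eq_cornerSymmetric hX' h0' hne'
  have hXe : X = ((g⁻¹ : GL (Fin 3) K) : Matrix (Fin 3) (Fin 3) K) * !![0, 0, 0; 0, 0, 0; c, 0, 0] * (g : Matrix (Fin 3) (Fin 3) K) := by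
    rw [← hgX, coe_inv_mul_conj_mul_coe]
  have hXe' : X' = ((g'⁻¹ : GL (Fin 3) K) : Matrix (Fin 3) (Fin 3) K) * !![0, 0, 0; 0, 0, 0; c', 0, 0] * (g' : Matrix (Fin 3) (Fin 3) K) := by
    rw [← hgX', coe_inv_mul_conj_mul_coe]
  -- the common value: `d = c·s² = c′·s′²`
  have hs : d = c * (((g : Matrix (Fin 3) (Fin 3) K) *ᵥ u) 0) ^ 2 := by
    rw [← hu, hXe, dotProduct_mulVec_conj_of_mem hg, dotProduct_cornerSymmetric_form]
  have hs' : d = c' * (((g' : Matrix (Fin 3) (Fin 3) K) *ᵥ u') 0) ^ 2 := by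
    rw [← hu', hXe', dotProduct_mulVec_conj_of_mem hg', dotProduct_cornerSymmetric_form]
  have hs'0 : ((g' : Matrix (Fin 3) (Fin 3) K) *ᵥ u') 0 ≠ 0 := by
    intro h; apply hd; rw [hs', h]; ring
  have hcc : ∃ a : K, c' = a ^ 2 * c :=
    ⟨((g : Matrix (Fin 3) (Fin 3) K) *ᵥ u) 0 / ((g' : Matrix (Fin 3) (Fin 3) K) *ᵥ u') 0, by
      field_simp; linear_combination hs'.symm.trans hs⟩   -- `c′ s′² = c s²`
  obtain ⟨g₃, hg₃, hg₃N⟩ := (exists_orthogonal_conj_cornerSymmetric_iff hc').2 hcc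
  refine ⟨g'⁻¹ * (g₃ * g), mul_mem (inv_mem hg') (mul_mem hg₃ hg), ?_⟩
  rw [coe_mul_conj, coe_mul_conj, hgX, hg₃N, ← hgX', inv_inv, coe_inv_mul_conj_mul_coe]

end RankOne

end Literature.GroupTheory.SpecificGroups
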